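import Summits.AnomalousDissipation.AnomalousDissipation.Theorems.SolenoidalFractalHomogenisationLagrangianStepD1TailBoundDiag
import Summits.AnomalousDissipation.AnomalousDissipation.Theorems.SolenoidalFractalHomogenisationLagrangianStepSidebandMask
import Summits.AnomalousDissipation.AnomalousDissipation.Theorems.SolenoidalFractalHomogenisationLagrangianStepSidebandMeanSlot
import Summits.AnomalousDissipation.AnomalousDissipation.Theorems.SolenoidalFractalHomogenisationLagrangianStepSidebandXDefectSmall
import Summits.AnomalousDissipation.AnomalousDissipation.Theorems.SolenoidalFractalHomogenisationLagrangianStepSidebandAdjacentDecay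
import HarnessLib

/-!
# K1L_D `stub_D1_residueTail` (registry v17, stmt-AnomalousDissipation-27980) — lane A4 `hbound`, CASES A/B: FAR SLOT PAIRS — the source slot ended at
# least one full slot before the pickup slot starts (cyclically) (helper; `--supports stmt-AnomalousDissipation-27980`)

Summits-side helper file of route `SolenoidalFractalHomogenisation` (prover seat `ad-sawtooth-k1loc-p1` g13, lane A owner; cases A (`j ≥ j'+2`) and B
(`j < j'`, not the wrap pair `(0,25)`) of the tail certificate `Lines/onelevel-D1-tail-cert.md` §3).  Everything proved; no definitions, no named facts, no sorry.
* `start_succ`, `period_eq_start_last` — slot-time bookkeeping of a lattice word; `response_eq_responseExt` on `[0,P]`;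
* **`tail_bound_far_core`** — if the envelope of the source slot `j'` vanishes on `[a, endⱼ)` and `a + τ¹_{i₀} ≤ startⱼ` for some slot `i₀` (one full slot of free
  decay) and the pair carries no fresh part (`freshMat S j j' = 0`), then `|tailKernel ν S p q j j'| ≤ gTail j j'·√PpSq_j(p)·√PpSq_{j'}(q)`
  (pickup `norm_inner_feedback_le`, state `norm_responseExt_apply_le`, decay `norm_responseExt_le_exp_of_envelope_zero`, `e^{−θ_{i₀}} ≤ e^{−θmin}`, `tail_arith`);
* **`tail_bound_caseA`** (`j'+2 ≤ j`: `a = end_{j'}`, `i₀ = j'+1`) and **`tail_bound_caseB`** (`j < j'`, `(j,j') ≠ (0,25)`: `a = end_{j'} − P₁`, `i₀ ∈ {0, 25}`).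
NOT a proof of the registered stub, of the crux, or of anomalous dissipation; rung leaf F-D1 infrastructure.
-/

set_option linter.dupNamespace false

noncomputable section

namespace Summit.AnomalousDissipation.AnomalousDissipation.Theorems.SolenoidalFractalHomogenisation.LagrangianStep.D1Tail

open Summit.AnomalousDissipation.AnomalousDissipation.Theorems
open Summit.AnomalousDissipation.AnomalousDissipation.Theorems.SolenoidalFractalHomogenisation.LagrangianStep
open Summit.AnomalousDissipation.AnomalousDissipation.Theorems.SolenoidalFractalHomogenisation.LagrangianStep.WCrossing
open Summit.AnomalousDissipation.AnomalousDissipation.Theorems.SolenoidalFractalHomogenisation.LagrangianStep.D1ResidueCert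
open Summit.AnomalousDissipation.AnomalousDissipation.Theorems.SolenoidalFractalHomogenisation.LagrangianStep.D1TailCert
open Summit.AnomalousDissipation.AnomalousDissipation.Theorems.SolenoidalFractalHomogenisation.LagrangianStep.Sideband
open Summit.AnomalousDissipation.AnomalousDissipation.Theorems.SolenoidalFractalHomogenisation.LagrangianStep.CellChain (start_stretch_stretch)
open Summit.AnomalousDissipation.AnomalousDissipation.Theorems.SolenoidalFractalHomogenisation.PermissibleCarrier
  (period_pos start_nonneg start_add_tau_le_period)
open Summit.AnomalousDissipation.AnomalousDissipation.Theorems.SolenoidalFractalHomogenisation.RealisedQuasiStaticCellLaw (start_add_tau_le_start)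
open Literature.Analysis Literature.Analysis.FluidPDE Literature.Analysis.FunctionSpaces Literature.Analysis.FunctionSpaces.Torus
open Literature.Analysis.FluidPDE.Torus Literature.Analysis.FluidPDE.LatticeShear
open Set Real Complex MeasureTheory intervalIntegral
open scoped InnerProductSpace

/-! ## §0 Slot-time bookkeeping -/

/-- `start_{j+1} = startⱼ + τⱼ`. [folklore] -/
theorem start_succ {k : ℕ} (W : LatticeWord k) (j : Fin k) (hj : j.val + 1 < k) :
    W.start ⟨j.val + 1, hj⟩ = W.start j + (W.phase j).τ := by
  unfold LatticeWord.start
  have h : Finset.univ.filter (· < (⟨j.val + 1, hj⟩ : Fin k)) = insert j (Finset.univ.filter (· < j)) := by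
    ext i
    simp only [Finset.mem_filter, Finset.mem_univ, true_and, Finset.mem_insert, Fin.lt_def, Fin.ext_iff]
    omega
  rw [h, Finset.sum_insert (by simp), add_comm]

/-- `period = start_{last} + τ_{last}`. [folklore] -/
theorem period_eq_start_last {k : ℕ} (W : LatticeWord (k + 1)) : W.period = W.start (Fin.last k) + (W.phase (Fin.last k)).τ := by
  unfold LatticeWord.period LatticeWord.start
  have h : (Finset.univ : Finset (Fin (k + 1))) = insert (Fin.last k) (Finset.univ.filter (· < Fin.last k)) := by
    ext i
    simp only [Finset.mem_univ, Finset.mem_insert, Finset.mem_filter, true_and, Fin.lt_def, Fin.val_last, Fin.ext_iff, true_iff]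
    have := i.isLt
    omega
  conv_lhs => rw [h]
  rw [Finset.sum_insert (by simp), add_comm]

/-- `start₀ = 0`. [folklore] -/
theorem start_zero {k : ℕ} (W : LatticeWord (k + 1)) : W.start 0 = 0 := by
  unfold LatticeWord.start
  rw [Finset.sum_eq_zero]
  intro i hi
  simp only [Finset.mem_filter, Fin.lt_def, Fin.val_zero] at hi
  omega

/-- On `[0, P]` the response is its periodic extension. [cite: SandersVerhulstMurdock2007, Lemma 5.2.7 (linear case)] -/
theorem response_eq_responseExt {k₀ : ℕ} (W₁ : LatticeWord k₀) (𝔸 : Torus.Visc4 (Fin 3)) (γ₁ : ℝ) (R : ℕ) (j : Fin k₀)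
    (hN : IsPeriodicResponse W₁ 𝔸 γ₁ R j (response W₁ 𝔸 γ₁ R j)) {t : ℝ} (ht : t ∈ Icc 0 W₁.period) :
    response W₁ 𝔸 γ₁ R j t = responseExt W₁ 𝔸 γ₁ R j t := by
  rcases lt_or_eq_of_le ht.2 with h | h
  · rw [responseExt_of_mem_Ico W₁ 𝔸 γ₁ R j ⟨ht.1, h⟩]
  · rw [h, hN.2.2, ← responseExt_of_mem_Ico W₁ 𝔸 γ₁ R j ⟨le_rfl, period_pos W₁⟩, ← responseExt_add_period, zero_add]

/-! ## §1 The far-pair core -/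

set_option maxHeartbeats 400000 in
/-- **FAR-PAIR CORE BOUND.**  `ν ∈ (0, 1/40]`, `NearIso S (10/11) (11/10)`, `W₁ = (cubatureWord.stretch MB).stretch (1/ν)`.  If the envelope of the source
slot `j'` vanishes on `[a, startⱼ + τ¹ⱼ)`, `a + τ¹_{i₀} ≤ startⱼ` for some slot `i₀`, and `freshMat S j j' = 0`, then
`|tailKernel ν S p q j j'| ≤ gTail j j' · (√PpSq_j(p) · √PpSq_{j'}(q))`. [cite: ArmstrongVicol2025, §3] [cite: SandersVerhulstMurdock2007, Lemma 5.2.7] -/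
theorem tail_bound_far_core {ν : ℝ} (hν : ν ∈ Ioc (0:ℝ) (1 / 40)) {S : T4} (hS : Torus.NearIso S (10 / 11) (11 / 10)) (p q : Fin 3 → ℝ)
    {j j' : Fin 26} (hfresh : freshMat S j j' = 0) (a : ℝ) (i₀ : Fin 26)
    (hgap : a + (((cubatureWord.stretch MB MB_pos).stretch (1 / ν) (one_div_pos.mpr hν.1)).phase i₀).τ ≤
      ((cubatureWord.stretch MB MB_pos).stretch (1 / ν) (one_div_pos.mpr hν.1)).start j)
    (henv : ∀ u ∈ Ico a (((cubatureWord.stretch MB MB_pos).stretch (1 / ν) (one_div_pos.mpr hν.1)).start j +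
      (((cubatureWord.stretch MB MB_pos).stretch (1 / ν) (one_div_pos.mpr hν.1)).phase j).τ),
      slotEnvelope ((cubatureWord.stretch MB MB_pos).stretch (1 / ν) (one_div_pos.mpr hν.1)) j' u = 0) :
    |tailKernel ν S p q j j'| ≤ gTail j j' * (Real.sqrt (PpSq j p) * Real.sqrt (PpSq j' q)) := by
  have hν' := hν
  obtain ⟨hν0, hν40⟩ := hν'
  set W₁ := (cubatureWord.stretch MB MB_pos).stretch (1 / ν) (one_div_pos.mpr hν0) with hW₁
  have h𝔸 : Torus.NearIso (ν • S) (ν * (10 / 11)) (ν * (11 / 10)) := hS.smul hν0.le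
  have hlo : 0 < ν * (10 / 11) := by positivity
  set r := min (1:ℝ) (4 * π ^ 2 * (ν * (10 / 11))) with hr
  have hr0 : 0 ≤ r := le_min zero_le_one (by positivity)
  have hrmin : r = 4 * π ^ 2 * (ν * (10 / 11)) := min_one_viscRate ⟨hν0, hν40⟩
  have hNj' := isPeriodicResponse_cubature hν0 hS j'
  set N := response W₁ (ν • S) 1 (R0 ν) j' with hNdef
  set Nb := responseExt W₁ (ν • S) 1 (R0 ν) j' with hNb
  set pC : EuclideanSpace ℂ (Fin 3) := WithLp.toLp 2 fun i => ((p i : ℝ) : ℂ) with hpC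
  set qC : EuclideanSpace ℂ (Fin 3) := WithLp.toLp 2 fun i => ((q i : ℝ) : ℂ) with hqC
  set s := W₁.start j with hs
  set L := (W₁.phase j).τ with hL
  have hLpos : 0 < L := (W₁.phase j).τ_pos
  have hs0 : 0 ≤ s := start_nonneg W₁ j
  have hsP : s + L ≤ W₁.period := start_add_tau_le_period W₁ j
  -- state / pickup constants
  set SUP : ℝ := 8 * π * ‖slotAmp W₁ j'‖ / r * ‖transversalProj (cubatureWord.phase j').m qC‖ with hSUP
  set C : ℝ := 1 / (2 * ‖latticeVec (cubatureWord.phase j).m‖) * ‖transversalProj (cubatureWord.phase j).m pC‖ * (2 * (Real.exp (-θmin) * SUP))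
    with hC
  have hSUP0 : 0 ≤ SUP := by rw [hSUP]; positivity
  -- pointwise state bound in the pickup slot
  have hstate : ∀ t ∈ Icc s (s + L), ‖N t qC‖ ≤ Real.exp (-θmin) * SUP := by
    intro t ht
    have htP : t ∈ Icc 0 W₁.period := ⟨hs0.trans ht.1, ht.2.trans hsP⟩
    rw [hNdef, response_eq_responseExt W₁ (ν • S) 1 (R0 ν) j' hNj' htP]
    have hat : a ≤ t := by linarith [ht.1, (W₁.phase i₀).τ_pos]
    have hdec := norm_responseExt_le_exp_of_envelope_zero W₁ h𝔸 hlo.le 1 (R0 ν) j' hNj' qC hat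
      (fun u hu => henv u ⟨hu.1, lt_of_lt_of_le hu.2 ht.2⟩)
    have hsup : ‖responseExt W₁ (ν • S) 1 (R0 ν) j' a qC‖ ≤ SUP := norm_responseExt_apply_le W₁ h𝔸 hlo one_pos (R0 ν) j' a qC
    have hθ : Real.exp (-(r * (t - a))) ≤ Real.exp (-θmin) := by
      refine (Real.exp_le_exp.mpr ?_).trans (exp_neg_θs_le i₀)
      have h1 : (W₁.phase i₀).τ ≤ t - a := by linarith [ht.1]
      have h2 : r * (W₁.phase i₀).τ = θs i₀ := by rw [hrmin, hW₁, tau_stretch_stretch cubatureWord MB_pos hν0 i₀]; exact viscRate_mul_slotLen hν0 i₀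
      nlinarith [mul_le_mul_of_nonneg_left h1 hr0]
    calc ‖responseExt W₁ (ν • S) 1 (R0 ν) j' t qC‖ ≤ Real.exp (-(r * (t - a))) * ‖responseExt W₁ (ν • S) 1 (R0 ν) j' a qC‖ := hdec
      _ ≤ Real.exp (-θmin) * SUP := mul_le_mul hθ hsup (norm_nonneg _) (Real.exp_pos _).le
  -- pointwise pairing bound
  have hpt : ∀ t ∈ Set.uIoc s (s + L), ‖⟪pC, feedback W₁ (R0 ν) j t (N t qC)⟫_ℂ‖ ≤ C := by
    intro t ht
    rw [Set.uIoc_of_le (by linarith)] at ht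
    have ht' : t ∈ Icc s (s + L) := ⟨ht.1.le, ht.2⟩
    have htP : t ∈ Icc 0 W₁.period := ⟨hs0.trans ht'.1, ht'.2.trans hsP⟩
    have hfa := transversalProj_coordL_response W₁ h𝔸 hlo one_pos (R := R0 ν) j' htP qC (W₁.phase j).m (-(W₁.phase j).m) (Or.inr rfl)
    have hfb := transversalProj_coordL_response W₁ h𝔸 hlo one_pos (R := R0 ν) j' htP qC (W₁.phase j).m ((W₁.phase j).m) (Or.inl rfl)
    have hpick := norm_inner_feedback_le W₁ (R0 ν) j t pC (y := N t qC) hfa hfb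
    have hy1 : ‖coordL (R0 ν) (-(W₁.phase j).m) (N t qC)‖ ≤ Real.exp (-θmin) * SUP := (norm_coordL_le _ _).trans (hstate t ht')
    have hy2 : ‖coordL (R0 ν) (W₁.phase j).m (N t qC)‖ ≤ Real.exp (-θmin) * SUP := (norm_coordL_le _ _).trans (hstate t ht')
    have h0 : 0 ≤ 1 / (2 * ‖latticeVec (W₁.phase j).m‖) * ‖transversalProj (W₁.phase j).m pC‖ := by positivity
    calc ‖⟪pC, feedback W₁ (R0 ν) j t (N t qC)⟫_ℂ‖
        ≤ 1 / (2 * ‖latticeVec (W₁.phase j).m‖) * ‖transversalProj (W₁.phase j).m pC‖ *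
            (‖coordL (R0 ν) (-(W₁.phase j).m) (N t qC)‖ + ‖coordL (R0 ν) (W₁.phase j).m (N t qC)‖) := hpick
      _ ≤ 1 / (2 * ‖latticeVec (W₁.phase j).m‖) * ‖transversalProj (W₁.phase j).m pC‖ * (2 * (Real.exp (-θmin) * SUP)) :=
            mul_le_mul_of_nonneg_left (by linarith) h0
      _ = C := by rw [hC]; rfl
  -- the pairing with the period mean
  have hI := intervalIntegrable_feedback_comp W₁ (ν • S) 1 (R0 ν) j j' hNj' hs0 (by linarith) hsP
  have hX : ∫ t in s..s + L, (((feedback W₁ (R0 ν) j t).restrictScalars ℝ).comp (N t)) qC = ∫ t in s..s + L, feedback W₁ (R0 ν) j t (N t qC) :=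
    intervalIntegral.integral_congr fun t _ => rfl
  have hXint : IntervalIntegrable (fun t => feedback W₁ (R0 ν) j t (N t qC)) volume s (s + L) := by
    have h := ((continuousOn_feedback_comp W₁ (ν • S) 1 (R0 ν) j j' hNj').mono (Icc_subset_Icc hs0 hsP)).clm_apply
      (continuousOn_const (c := qC))
    exact (h.congr fun t _ => rfl).intervalIntegrable_of_Icc (by linarith)
  have hM : meanFeedback W₁ (ν • S) 1 (R0 ν) j j' qC = (1 / W₁.period) • ∫ t in s..s + L, feedback W₁ (R0 ν) j t (N t qC) := by
    rw [meanFeedback_eq_slot_integral W₁ (ν • S) 1 (R0 ν) j j' ⟨_, hNj'⟩, _root_.smul_apply, ContinuousLinearMap.intervalIntegral_apply hI qC, hX]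
  -- assemble through the common end game
  have h0 : (0 : Matrix (Fin 3) (Fin 3) ℝ).map ((↑) : ℝ → ℂ) = 0 := by ext i j; simp
  have hM' : ν / (4 * π ^ 2) * (⟪pC, meanFeedback W₁ (ν • S) 1 (R0 ν) j j' qC⟫_ℂ).re -
      (⟪pC, Matrix.toEuclideanCLM (n := Fin 3) (𝕜 := ℂ) ((freshMat S j j').map ((↑) : ℝ → ℂ)) qC⟫_ℂ).re =
      ν / (4 * π ^ 2) * (⟪pC, (1 / W₁.period) • ∫ t in s..s + L, feedback W₁ (R0 ν) j t (N t qC)⟫_ℂ).re := by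
    rw [hM, hfresh, h0, map_zero, _root_.zero_apply, inner_zero_right, Complex.zero_re, sub_zero]
  have hpt' : ∀ t ∈ Set.uIoc s (s + L), ‖⟪pC, feedback W₁ (R0 ν) j t (N t qC)⟫_ℂ‖ ≤
      1 / (2 * ‖latticeVec (cubatureWord.phase j).m‖) * ‖transversalProj (cubatureWord.phase j).m pC‖ *
        (2 * (Real.exp (-θmin) * (8 * π * ‖slotAmp W₁ j'‖ / min (1:ℝ) (4 * π ^ 2 * (ν * (10 / 11))) * ‖transversalProj (cubatureWord.phase j').m qC‖))) := by
    intro t ht; have h := hpt t ht; rw [hC, hSUP, hr] at h; exact h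
  exact tail_bound_of_decomp hν S p q j j' _ hXint hM' hpt'

/-! ## §2 No fresh part off the diagonal and the forward pairs -/

/-- A pair which is neither diagonal nor a forward colinear pair carries no fresh part. [cite: ArmstrongVicol2025, §3] -/
theorem freshMat_eq_zero (S : T4) {j j' : Fin 26} (hne : j ≠ j') (hnp : j.val ≠ j'.val + 1) : freshMat S j j' = 0 := by
  rw [freshMat_def, if_neg hne, zero_add]
  refine Finset.sum_eq_zero fun l _ => if_neg ?_
  rintro ⟨h1, h2⟩
  apply hnp
  rw [h1, h2]
  simp [sndSlot, fstSlot]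

/-! ## §3 Case A: the source slot ended at least one full slot earlier in the same period -/

/-- **CASE A** (`j'+2 ≤ j`): `|tailKernel ν S p q j j'| ≤ gTail j j' · (√PpSq_j(p) · √PpSq_{j'}(q))`. [cite: ArmstrongVicol2025, §3]
[cite: SandersVerhulstMurdock2007, Lemma 5.2.7] -/
theorem tail_bound_caseA {ν : ℝ} (hν : ν ∈ Ioc (0:ℝ) (1 / 40)) {S : T4} (hS : Torus.NearIso S (10 / 11) (11 / 10)) (p q : Fin 3 → ℝ)
    {j j' : Fin 26} (hA : j'.val + 2 ≤ j.val) :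
    |tailKernel ν S p q j j'| ≤ gTail j j' * (Real.sqrt (PpSq j p) * Real.sqrt (PpSq j' q)) := by
  set W₁ := (cubatureWord.stretch MB MB_pos).stretch (1 / ν) (one_div_pos.mpr hν.1) with hW₁
  have hi₀ : j'.val + 1 < 26 := by have := j.isLt; omega
  set i₀ : Fin 26 := ⟨j'.val + 1, hi₀⟩ with hi₀def
  have hsucc : W₁.start i₀ = W₁.start j' + (W₁.phase j').τ := start_succ W₁ j' hi₀
  have hlt : i₀ < j := by rw [Fin.lt_def]; simp only [hi₀def]; omega
  refine tail_bound_far_core hν hS p q (freshMat_eq_zero S (by intro h; rw [h] at hA; omega) (by omega))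
    (W₁.start j' + (W₁.phase j').τ) i₀ ?_ ?_
  · rw [← hsucc]; exact start_add_tau_le_start W₁ hlt
  · intro u hu
    exact slotEnvelope_eq_zero_of_end_le W₁ j' hu.1 (hu.2.le.trans (start_add_tau_le_period W₁ j))

/-! ## §4 Case B: the source slot lies later in the period (previous period's injection) -/

/-- **CASE B** (`j < j'`, `(j, j') ≠ (0, 25)`): `|tailKernel ν S p q j j'| ≤ gTail j j' · (√PpSq_j(p) · √PpSq_{j'}(q))` — decay across the period junction through
the periodic extension of the response. [cite: ArmstrongVicol2025, §3] [cite: SandersVerhulstMurdock2007, Lemma 5.2.7] -/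
theorem tail_bound_caseB {ν : ℝ} (hν : ν ∈ Ioc (0:ℝ) (1 / 40)) {S : T4} (hS : Torus.NearIso S (10 / 11) (11 / 10)) (p q : Fin 3 → ℝ)
    {j j' : Fin 26} (hB : j.val < j'.val) (hB' : ¬(j.val = 0 ∧ j'.val = 25)) :
    |tailKernel ν S p q j j'| ≤ gTail j j' * (Real.sqrt (PpSq j p) * Real.sqrt (PpSq j' q)) := by
  set W₁ := (cubatureWord.stretch MB MB_pos).stretch (1 / ν) (one_div_pos.mpr hν.1) with hW₁
  have hjj' : j < j' := by rw [Fin.lt_def]; exact hB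
  have hP : W₁.period = W₁.start (Fin.last 25) + (W₁.phase (Fin.last 25)).τ := period_eq_start_last W₁
  have he'P : W₁.start j' + (W₁.phase j').τ ≤ W₁.period := start_add_tau_le_period W₁ j'
  -- the slot providing the full decay: slot `0` if `j ≥ 1`, slot `25` if `j = 0` (then `j' ≤ 24`)
  have hgap : ∃ i₀ : Fin 26, W₁.start j' + (W₁.phase j').τ - W₁.period + (W₁.phase i₀).τ ≤ W₁.start j := by
    by_cases hj0 : j.val = 0
    · have hj'25 : j'.val < 25 := by have := j'.isLt; omega
      have hlt : j' < Fin.last 25 := by rw [Fin.lt_def, Fin.val_last]; exact hj'25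
      refine ⟨Fin.last 25, ?_⟩
      have h1 := start_add_tau_le_start W₁ hlt
      linarith [start_nonneg W₁ j]
    · have hlt : (0 : Fin 26) < j := by rw [Fin.lt_def, Fin.val_zero]; omega
      refine ⟨0, ?_⟩
      have h1 := start_add_tau_le_start W₁ hlt
      rw [start_zero, zero_add] at h1
      linarith
  obtain ⟨i₀, hi₀⟩ := hgap
  refine tail_bound_far_core hν hS p q (freshMat_eq_zero S (by intro h; rw [h] at hB; omega) (by omega))
    (W₁.start j' + (W₁.phase j').τ - W₁.period) i₀ hi₀ ?_
  intro u hu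
  show slotEnvelope W₁ j' u = 0
  by_cases hu0 : u < 0
  · have h := slotEnvelope_add_int_mul_period W₁ j' (u + W₁.period) (-1)
    rw [show u + W₁.period + ((-1 : ℤ) : ℝ) * W₁.period = u by push_cast; ring] at h
    rw [h]
    exact slotEnvelope_eq_zero_of_end_le W₁ j' (by linarith [hu.1]) (by linarith)
  · have hej : W₁.start j + (W₁.phase j).τ ≤ W₁.start j' := start_add_tau_le_start W₁ hjj'
    exact slotEnvelope_eq_zero_of_le_start W₁ j' (not_lt.mp hu0) (hu.2.le.trans hej)

end Summit.AnomalousDissipation.AnomalousDissipation.Theorems.SolenoidalFractalHomogenisation.LagrangianStep.D1Tail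

end
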